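import Literature.NumberTheory.DiophantineApproximation.DilogHermitePade
import Mathlib.Algebra.Polynomial.Derivative
import Mathlib.Algebra.Polynomial.FieldDivision
import Mathlib.RingTheory.Coprime.Lemmas
import Mathlib.Data.Nat.Factorial.BigOperators
import HarnessLib

/-!
# Partial fractions of the type-I Hermite–Padé kernel for `1, Li₁, Li₂`

Topic `Literature/NumberTheory/DiophantineApproximation`. For the kernel of
`DilogHermitePade.lean`,

  `R_n(t) = ∏_{j=1}^{2n} (t − j) / ∏_{i=0}^{n} (t + i)²`  (`DilogPade.kernel`),

we prove the partial fraction expansion at its double poles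

  `R_n(t) = ∑_{i=0}^{n} ( A_{n,i}/(t+i)² + B_{n,i}/(t+i) )`  (`DilogPade.kernel_eq_partialFractions`)

with the explicit coefficients of the vocabulary file: `A_{n,i} = C(2n+i,i) C(2n,n) C(n,i)²`
(`DilogPade.coefA`) and `B_{n,i} = −A_{n,i} H_{n,i}` (`DilogPade.coefB`, `DilogPade.harm`). This
is the algebraic heart of the classical type-I Hermite–Padé proof of the linear independence of
`1, Li₁(1/N), Li₂(1/N)` (Nikišin 1979; Hata 1990; David–Hirata-Kohno–Kawashima 2020, Thm 2.1).

Proof: the polynomial identity `P = ∑_i (A_i + B_i (X + i)) M_i`, `P = ∏_j (X − j)`,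
`M_i = ∏_{l ≠ i} (X + l)²`, holds because the difference is divisible by every `(X + i)²`
(its value and its derivative vanish at `−i`: the value by the binomial identity
`A_i (i!)² ((n−i)!)² = (i+1)⋯(i+2n)`, the derivative by the logarithmic derivatives
`P'/P(−i) = −∑_j 1/(i+j)` and `M_i'/M_i(−i) = 2 ∑_{l≠i} 1/(l−i)`, which is how `H_{n,i}` was
defined), the `(X + i)²` are pairwise coprime, and the difference has degree `≤ 2n + 1 < 2n + 2`.
Dividing by `∏ (t + i)²` gives the expansion at every real `t` off the poles.

References: E. M. Nikišin, Mat. Sb. 109 (1979); M. Hata, J. Math. Pures Appl. 69 (1990);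
S. David, N. Hirata-Kohno, M. Kawashima, Moscow J. Comb. Number Th. 9 (2020), Thm 2.1.
-/

noncomputable section

open Finset Polynomial

namespace Literature.NumberTheory.DiophantineApproximation

namespace DilogPade

/-! ## Two generic polynomial facts -/

/-- Logarithmic derivative of a finite product of polynomials at a point where no factor
vanishes: `(∏ f_k)'(a) = (∏ f_k(a)) · ∑_k f_k'(a)/f_k(a)`. [folklore] -/
theorem eval_derivative_prod {ι : Type*} [DecidableEq ι] (s : Finset ι) (f : ι → ℝ[X]) (a : ℝ)
    (hf : ∀ k ∈ s, (f k).eval a ≠ 0) :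
    (derivative (∏ k ∈ s, f k)).eval a =
      (∏ k ∈ s, (f k).eval a) * ∑ k ∈ s, (derivative (f k)).eval a / (f k).eval a := by
  rw [derivative_prod_finset, eval_finsetSum, mul_sum]
  refine sum_congr rfl fun k hk => ?_
  rw [eval_mul, eval_prod, mul_div_assoc', eq_div_iff (hf k hk), mul_right_comm,
    prod_erase_mul _ _ hk]

/-- A double root criterion: if `p(a) = 0` and `p'(a) = 0` then `(X − a)² ∣ p`. [folklore] -/
theorem X_sub_C_sq_dvd {p : ℝ[X]} {a : ℝ} (h0 : p.eval a = 0) (h1 : (derivative p).eval a = 0) :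
    (X - C a) ^ 2 ∣ p := by
  obtain ⟨q, hq⟩ := dvd_iff_isRoot.2 h0
  have hq' : q.eval a = 0 := by
    have := h1
    rw [hq, derivative_mul, derivative_X_sub_C, one_mul, eval_add, eval_mul, eval_sub, eval_X,
      eval_C, sub_self, zero_mul, add_zero] at this
    exact this
  obtain ⟨r, hr⟩ := dvd_iff_isRoot.2 hq'
  exact ⟨r, by rw [hq, hr, pow_two, mul_assoc]⟩

/-- The same criterion at `−a`: if `p(−a) = 0` and `p'(−a) = 0` then `(X + a)² ∣ p`. [folklore] -/
theorem X_add_C_sq_dvd {p : ℝ[X]} {a : ℝ} (h0 : p.eval (-a) = 0)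
    (h1 : (derivative p).eval (-a) = 0) : (X + C a) ^ 2 ∣ p := by
  have h := X_sub_C_sq_dvd h0 h1
  rwa [C_neg, sub_neg_eq_add] at h

/-! ## The pieces of the kernel as polynomials, and their values at the poles -/

/-- The value of the numerator polynomial `∏_{j<2n} (X − (j+1))` at the pole `−i`:
`∏_{j<2n} (i + j + 1)` (an even number of sign changes). [folklore] -/
theorem eval_neg_numPoly (n i : ℕ) :
    (∏ j ∈ range (2 * n), (X - C ((j : ℝ) + 1))).eval (-(i : ℝ)) =
      ∏ j ∈ range (2 * n), ((i : ℝ) + j + 1) := by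
  rw [eval_prod]
  simp only [eval_sub, eval_X, eval_C]
  have : ∀ j ∈ range (2 * n), (-(i : ℝ) - ((j : ℝ) + 1)) = (-1) * ((i : ℝ) + j + 1) := by
    intro j _; ring
  rw [prod_congr rfl this, prod_mul_distrib, prod_const, card_range, pow_mul, neg_one_sq, one_pow,
    one_mul]

/-- The punctured set of poles splits into the poles below and above `i`. [folklore] -/
theorem range_succ_erase_eq (n i : ℕ) (hi : i ≤ n) :
    (range (n + 1)).erase i = range i ∪ Ico (i + 1) (n + 1) := by
  ext l
  simp only [mem_erase, mem_range, mem_union, mem_Ico]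
  omega

/-- The value of `M_i = ∏_{l ≤ n, l ≠ i} (X + l)²` at `−i`: `(i!)² ((n−i)!)²`. [folklore] -/
theorem eval_neg_piecePoly (n i : ℕ) (hi : i ≤ n) :
    (∏ l ∈ (range (n + 1)).erase i, (X + C (l : ℝ)) ^ 2).eval (-(i : ℝ)) =
      ((i.factorial : ℝ) * ((n - i).factorial : ℝ)) ^ 2 := by
  rw [eval_prod]
  simp only [eval_pow, eval_add, eval_X, eval_C]
  rw [range_succ_erase_eq n i hi, prod_union, prod_Ico_eq_prod_range,
    show n + 1 - (i + 1) = n - i by omega]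
  · -- below `i`: `∏_{l<i} (l − i)² = (i!)²`; above: `∏_{m<n-i} (m+1)² = ((n−i)!)²`
    have h1 : ∏ l ∈ range i, (-(i : ℝ) + (l : ℝ)) ^ 2 = (i.factorial : ℝ) ^ 2 := by
      have : ∀ l ∈ range i, (-(i : ℝ) + (l : ℝ)) ^ 2 = ((i : ℝ) - l) ^ 2 := fun l _ => by ring
      rw [prod_congr rfl this, prod_pow]
      congr 1
      rw [← prod_range_add_one_eq_factorial, Nat.cast_prod]
      conv_rhs => rw [← prod_range_reflect]
      refine prod_congr rfl fun l hl => ?_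
      rw [mem_range] at hl
      rw [show i - 1 - l + 1 = i - l by omega, Nat.cast_sub hl.le]
    have h2 : ∏ k ∈ range (n - i), (-(i : ℝ) + ((i + 1 + k : ℕ) : ℝ)) ^ 2 =
        ((n - i).factorial : ℝ) ^ 2 := by
      rw [← prod_range_add_one_eq_factorial, Nat.cast_prod, ← prod_pow]
      refine prod_congr rfl fun k _ => ?_
      push_cast; ring
    rw [h1, h2]; ring
  · rw [disjoint_left]
    intro l h1 h2
    rw [mem_range] at h1
    rw [mem_Ico] at h2
    omega

/-- The binomial identity behind the residues: `A_{n,i} · (i!)² ((n−i)!)² = ∏_{j<2n} (i+j+1)`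
(`= (2n+i)!/i!`). [folklore] -/
theorem coefA_mul_factorial_sq (n i : ℕ) (hi : i ≤ n) :
    coefA n i * (i.factorial * (n - i).factorial) ^ 2 = ∏ j ∈ range (2 * n), (i + j + 1) := by
  have hprod : i.factorial * ∏ j ∈ range (2 * n), (i + j + 1) = (i + 2 * n).factorial := by
    rw [← Nat.factorial_mul_ascFactorial i (2 * n), Nat.ascFactorial_eq_prod_range]
    congr 1
    exact prod_congr rfl fun j _ => by ring
  have h1 : n.choose i * i.factorial * (n - i).factorial = n.factorial :=
    Nat.choose_mul_factorial_mul_factorial hi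
  have h2 : (2 * n).choose n * n.factorial * n.factorial = (2 * n).factorial := by
    have := Nat.choose_mul_factorial_mul_factorial (show n ≤ 2 * n by omega)
    rwa [show 2 * n - n = n by omega] at this
  have h3 : (2 * n + i).choose i * i.factorial * (2 * n).factorial = (2 * n + i).factorial := by
    have := Nat.choose_mul_factorial_mul_factorial (show i ≤ 2 * n + i by omega)
    rwa [show 2 * n + i - i = 2 * n by omega] at this
  apply Nat.eq_of_mul_eq_mul_left (Nat.factorial_pos i)
  rw [hprod, show i + 2 * n = 2 * n + i by ring, ← h3, ← h2, ← h1, coefA]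
  ring

/-- The same identity over `ℝ`, in the form `A_{n,i} · M_i(−i) = P(−i)`. [folklore] -/
theorem coefA_mul_eval_neg_piecePoly (n i : ℕ) (hi : i ≤ n) :
    (coefA n i : ℝ) * (∏ l ∈ (range (n + 1)).erase i, (X + C (l : ℝ)) ^ 2).eval (-(i : ℝ)) =
      (∏ j ∈ range (2 * n), (X - C ((j : ℝ) + 1))).eval (-(i : ℝ)) := by
  rw [eval_neg_piecePoly n i hi, eval_neg_numPoly]
  have h := congrArg (fun m : ℕ => (m : ℝ)) (coefA_mul_factorial_sq n i hi)
  push_cast at h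
  rw [← h]

/-! ## Logarithmic derivatives at the poles -/

/-- `P'(−i) = P(−i) · ∑_j 1/(−i − (j+1))`. [folklore] -/
theorem eval_derivative_numPoly (n i : ℕ) :
    (derivative (∏ j ∈ range (2 * n), (X - C ((j : ℝ) + 1)))).eval (-(i : ℝ)) =
      ((∏ j ∈ range (2 * n), (X - C ((j : ℝ) + 1)))).eval (-(i : ℝ)) * ∑ j ∈ range (2 * n), 1 / (-(i : ℝ) - ((j : ℝ) + 1)) := by
  have hf : ∀ j ∈ range (2 * n), (X - C ((j : ℝ) + 1)).eval (-(i : ℝ)) ≠ 0 := by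
    intro j _
    simp only [eval_sub, eval_X, eval_C]
    have : (0 : ℝ) < (i : ℝ) + ((j : ℝ) + 1) := by positivity
    intro h; linarith
  rw [eval_derivative_prod _ _ _ hf, eval_prod]
  congr 1
  refine sum_congr rfl fun j _ => ?_
  simp only [derivative_sub, derivative_X, derivative_C, sub_zero, eval_one, eval_sub, eval_X, eval_C]

/-- `M_i'(−i) = M_i(−i) · ∑_{l ≠ i} 2(−i + l)/(−i + l)²`. [folklore] -/
theorem eval_derivative_piecePoly (n i : ℕ) :
    (derivative (∏ l ∈ (range (n + 1)).erase i, (X + C ((l : ℕ) : ℝ)) ^ 2)).eval (-(i : ℝ)) =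
      ((∏ l ∈ (range (n + 1)).erase i, (X + C ((l : ℕ) : ℝ)) ^ 2)).eval (-(i : ℝ)) *
        ∑ l ∈ (range (n + 1)).erase i, 2 * (-(i : ℝ) + l) / (-(i : ℝ) + l) ^ 2 := by
  have hf : ∀ l ∈ (range (n + 1)).erase i, ((X + C ((l : ℕ) : ℝ)) ^ 2).eval (-(i : ℝ)) ≠ 0 := by
    intro l hl
    simp only [eval_pow, eval_add, eval_X, eval_C]
    have hli : l ≠ i := (mem_erase.1 hl).1
    have : (-(i : ℝ) + l) ≠ 0 := by
      intro h
      apply hli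
      exact_mod_cast (by linarith : (l : ℝ) = i)
    exact pow_ne_zero 2 this
  rw [eval_derivative_prod _ _ _ hf, eval_prod]
  congr 1
  refine sum_congr rfl fun l _ => ?_
  simp only [derivative_pow, Nat.cast_ofNat, derivative_add, derivative_X, derivative_C, add_zero,
    mul_one, eval_mul, eval_C, eval_pow, eval_add, eval_X, Nat.add_one_sub_one, pow_one]

/-! ## Divisibility of the defect by every `(X + i)²` -/

/-- For `l ≠ i` the `l`-th summand is divisible by `(X + i)²` (it is a factor of `M_l`). [folklore] -/
theorem sq_dvd_summand_of_ne {n i l : ℕ} (hi : i ∈ range (n + 1)) (hli : l ≠ i) :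
    (X + C ((i : ℕ) : ℝ)) ^ 2 ∣ ((C ((coefA n l : ℕ) : ℝ) + C (((coefB n l : ℚ) : ℝ)) * (X + C ((l : ℕ) : ℝ))) *
        (∏ k ∈ (range (n + 1)).erase l, (X + C ((k : ℕ) : ℝ)) ^ 2)) :=
  (Finset.dvd_prod_of_mem (fun k : ℕ => (X + C ((k : ℕ) : ℝ)) ^ 2)
    (mem_erase.2 ⟨hli.symm, hi⟩)).mul_left _

/-- The defining property of `harm`: at the `i`-th pole the two logarithmic derivatives combine
to `A_i ∑_j 1/(−i−(j+1)) − B_i − A_i ∑_{l≠i} 2(−i+l)/(−i+l)² = 0`. [folklore] -/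
theorem residue_bracket_eq_zero (n i : ℕ) :
    (coefA n i : ℝ) * ∑ j ∈ range (2 * n), 1 / (-(i : ℝ) - ((j : ℝ) + 1)) -
        ((coefB n i : ℚ) : ℝ) -
        (coefA n i : ℝ) * ∑ l ∈ (range (n + 1)).erase i, 2 * (-(i : ℝ) + l) / (-(i : ℝ) + l) ^ 2 =
      0 := by
  have hB : ((coefB n i : ℚ) : ℝ) = -((coefA n i : ℝ) * ((harm n i : ℚ) : ℝ)) := by
    simp [coefB]
  have hH : ((harm n i : ℚ) : ℝ) = (∑ j ∈ range (2 * n), 1 / ((i : ℝ) + j + 1)) +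
      2 * ∑ l ∈ (range (n + 1)).erase i, 1 / ((l : ℝ) - i) := by
    rw [harm, ← Finset.filter_ne']
    push_cast
    rfl
  have h1 : ∑ j ∈ range (2 * n), 1 / (-(i : ℝ) - ((j : ℝ) + 1)) =
      -∑ j ∈ range (2 * n), 1 / ((i : ℝ) + j + 1) := by
    rw [← sum_neg_distrib]
    refine sum_congr rfl fun j _ => ?_
    rw [show -(i : ℝ) - ((j : ℝ) + 1) = -((i : ℝ) + j + 1) by ring, one_div_neg_eq_neg_one_div]
  have h2 : ∑ l ∈ (range (n + 1)).erase i, 2 * (-(i : ℝ) + l) / (-(i : ℝ) + l) ^ 2 =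
      2 * ∑ l ∈ (range (n + 1)).erase i, 1 / ((l : ℝ) - i) := by
    rw [mul_sum]
    refine sum_congr rfl fun l hl => ?_
    have hli : l ≠ i := (mem_erase.1 hl).1
    have h : ((l : ℝ) - i) ≠ 0 := by
      intro h
      apply hli
      exact_mod_cast (by linarith : (l : ℝ) = i)
    rw [show -(i : ℝ) + l = (l : ℝ) - i by ring]
    field_simp
  rw [hB, hH, h1, h2]
  ring

/-- The `i`-th double pole: `(X + i)² ∣ P − S_i` (value by the binomial identity, derivative by the
logarithmic derivatives and the definition of `harm`). [folklore] -/
theorem sq_dvd_numPoly_sub_summand {n i : ℕ} (hi : i ≤ n) :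
    (X + C ((i : ℕ) : ℝ)) ^ 2 ∣ (∏ j ∈ range (2 * n), (X - C ((j : ℝ) + 1))) - ((C ((coefA n i : ℕ) : ℝ) + C (((coefB n i : ℚ) : ℝ)) * (X + C ((i : ℕ) : ℝ))) *
        (∏ l ∈ (range (n + 1)).erase i, (X + C ((l : ℕ) : ℝ)) ^ 2)) := by
  apply X_add_C_sq_dvd
  · -- value at `−i`
    rw [eval_sub, eval_mul, ← coefA_mul_eval_neg_piecePoly n i hi]
    simp only [eval_add, eval_mul, eval_C, eval_X, neg_add_cancel, mul_zero, add_zero, sub_self]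
  · -- derivative at `−i`
    rw [derivative_sub, eval_sub, derivative_mul, eval_add, eval_mul, eval_mul,
      eval_derivative_numPoly, eval_derivative_piecePoly, ← coefA_mul_eval_neg_piecePoly n i hi]
    simp only [derivative_add, derivative_mul, derivative_C, derivative_X,
      zero_mul, zero_add, mul_one, eval_add, eval_mul, eval_C, eval_X, neg_add_cancel, mul_zero,
      add_zero]
    have := residue_bracket_eq_zero n i
    set μ := ((∏ l ∈ (range (n + 1)).erase i, (X + C ((l : ℕ) : ℝ)) ^ 2)).eval (-(i : ℝ))
    linear_combination μ * this

/-- The `(X + i)²`, `i ≤ n`, are pairwise coprime over `ℝ`. [folklore] -/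
theorem pairwise_isCoprime_sq (n : ℕ) :
    ((range (n + 1) : Finset ℕ) : Set ℕ).Pairwise
      (Function.onFun IsCoprime fun i : ℕ => (X + C ((i : ℕ) : ℝ)) ^ 2) := by
  intro i _ l _ hil
  have h : IsCoprime (X - C (-(i : ℝ))) (X - C (-(l : ℝ))) := by
    apply isCoprime_X_sub_C_of_isUnit_sub
    rw [isUnit_iff_ne_zero, sub_ne_zero, neg_inj.ne]
    exact_mod_cast hil
  simp only [C_neg, sub_neg_eq_add] at h
  exact h.pow

/-! ## The polynomial identity and the partial fractions -/

/-- **The polynomial identity** `∏_{j<2n} (X − (j+1)) = ∑_{i ≤ n} (A_i + B_i (X + i)) ∏_{l≠i} (X + l)²`: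
the difference is divisible by the degree-`2n+2` polynomial `∏_{i≤n} (X + i)²` and has degree
`≤ 2n + 1`. [cite: DavidHirataKohnoKawashima2020, Thm 2.1] -/
theorem numPoly_eq_sum_summand (n : ℕ) : (∏ j ∈ range (2 * n), (X - C ((j : ℝ) + 1))) = ∑ i ∈ range (n + 1), ((C ((coefA n i : ℕ) : ℝ) + C (((coefB n i : ℚ) : ℝ)) * (X + C ((i : ℕ) : ℝ))) *
        (∏ l ∈ (range (n + 1)).erase i, (X + C ((l : ℕ) : ℝ)) ^ 2)) := by
  set E : ℝ[X] := (∏ j ∈ range (2 * n), (X - C ((j : ℝ) + 1))) - ∑ i ∈ range (n + 1), ((C ((coefA n i : ℕ) : ℝ) + C (((coefB n i : ℚ) : ℝ)) * (X + C ((i : ℕ) : ℝ))) *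
        (∏ l ∈ (range (n + 1)).erase i, (X + C ((l : ℕ) : ℝ)) ^ 2)) with hE
  -- every double pole divides the defect
  have hdvd : ∀ i ∈ range (n + 1), (X + C ((i : ℕ) : ℝ)) ^ 2 ∣ E := by
    intro i hi
    have hi' : i ≤ n := Nat.lt_succ_iff.1 (mem_range.1 hi)
    have hsplit : E = ((∏ j ∈ range (2 * n), (X - C ((j : ℝ) + 1))) - ((C ((coefA n i : ℕ) : ℝ) + C (((coefB n i : ℚ) : ℝ)) * (X + C ((i : ℕ) : ℝ))) *
        (∏ l ∈ (range (n + 1)).erase i, (X + C ((l : ℕ) : ℝ)) ^ 2))) - ∑ l ∈ (range (n + 1)).erase i, ((C ((coefA n l : ℕ) : ℝ) + C (((coefB n l : ℚ) : ℝ)) * (X + C ((l : ℕ) : ℝ))) *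
        (∏ k ∈ (range (n + 1)).erase l, (X + C ((k : ℕ) : ℝ)) ^ 2)) := by
      rw [hE, ← add_sum_erase _ _ hi]; ring
    rw [hsplit]
    refine dvd_sub (sq_dvd_numPoly_sub_summand hi') (dvd_sum fun l hl => ?_)
    exact sq_dvd_summand_of_ne hi (mem_erase.1 hl).1
  -- hence so does their product, which is monic of degree `2n + 2`
  have hQdvd : (∏ i ∈ range (n + 1), (X + C ((i : ℕ) : ℝ)) ^ 2) ∣ E :=
    Finset.prod_dvd_of_coprime (pairwise_isCoprime_sq n) hdvd
  have hQdeg : (∏ i ∈ range (n + 1), (X + C ((i : ℕ) : ℝ)) ^ 2).natDegree = 2 * n + 2 := by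
    rw [natDegree_prod_of_monic _ _ fun i _ => (monic_X_add_C _).pow 2]
    simp only [(monic_X_add_C _).natDegree_pow, natDegree_X_add_C, mul_one, sum_const, card_range,
      smul_eq_mul]
    ring
  -- while the defect has degree at most `2n + 1`
  have hPdeg : ((∏ j ∈ range (2 * n), (X - C ((j : ℝ) + 1)))).natDegree ≤ 2 * n := by
    refine (natDegree_prod_le _ _).trans ?_
    refine (sum_le_sum fun j _ => natDegree_X_sub_C_le (((j : ℕ) : ℝ) + 1)).trans ?_
    rw [sum_const, card_range, smul_eq_mul, mul_one]
  have hMdeg : ∀ i ∈ range (n + 1), ((∏ l ∈ (range (n + 1)).erase i, (X + C ((l : ℕ) : ℝ)) ^ 2)).natDegree ≤ 2 * n := by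
    intro i hi
    refine (natDegree_prod_le _ _).trans ?_
    refine (sum_le_sum fun l _ => natDegree_pow_le_of_le 2 (natDegree_X_add_C ((l : ℕ) : ℝ)).le).trans
      ?_
    rw [sum_const, card_erase_of_mem hi, card_range, smul_eq_mul]
    omega
  have hSdeg : ∀ i ∈ range (n + 1), (((C ((coefA n i : ℕ) : ℝ) + C (((coefB n i : ℚ) : ℝ)) * (X + C ((i : ℕ) : ℝ))) *
        (∏ l ∈ (range (n + 1)).erase i, (X + C ((l : ℕ) : ℝ)) ^ 2))).natDegree ≤ 2 * n + 1 := by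
    intro i hi
    refine natDegree_mul_le.trans ?_
    have h1 : (C ((coefA n i : ℕ) : ℝ) +
        C (((coefB n i : ℚ) : ℝ)) * (X + C ((i : ℕ) : ℝ))).natDegree ≤ 1 := by
      refine (natDegree_add_le _ _).trans (max_le (by simp) ?_)
      exact (natDegree_C_mul_le _ _).trans (natDegree_X_add_C _).le
    have := hMdeg i hi
    omega
  have hEdeg : E.natDegree ≤ 2 * n + 1 := by
    rw [hE]
    refine (natDegree_sub_le _ _).trans (max_le (hPdeg.trans (Nat.le_succ _)) ?_)
    exact natDegree_sum_le_of_forall_le _ _ hSdeg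
  have hE0 : E = 0 := eq_zero_of_dvd_of_natDegree_lt hQdvd (by rw [hQdeg]; omega)
  exact sub_eq_zero.1 hE0

/-- The numerator of the kernel is the value of `(∏ j ∈ range (2 * n), (X - C ((j : ℝ) + 1)))`. [folklore] -/
theorem eval_numPoly (n : ℕ) (t : ℝ) : ((∏ j ∈ range (2 * n), (X - C ((j : ℝ) + 1)))).eval t = num n t := by
  rw [eval_prod, num]
  simp only [eval_sub, eval_X, eval_C]

/-- The denominator of the kernel is `(t + i)² · M_i(t)` for every `i ≤ n`. [folklore] -/
theorem den_eq_mul_eval_piecePoly {n i : ℕ} (hi : i ∈ range (n + 1)) (t : ℝ) :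
    den n t = (t + i) ^ 2 * ((∏ l ∈ (range (n + 1)).erase i, (X + C ((l : ℕ) : ℝ)) ^ 2)).eval t := by
  rw [den, eval_prod, ← mul_prod_erase _ _ hi]
  simp only [eval_pow, eval_add, eval_X, eval_C]

/-- **Partial fractions of the Hermite–Padé kernel**: off the poles,
`R_n(t) = ∑_{i ≤ n} (A_{n,i}/(t+i)² + B_{n,i}/(t+i))`.
[cite: DavidHirataKohnoKawashima2020, Thm 2.1] -/
theorem kernel_eq_partialFractions (n : ℕ) {t : ℝ} (ht : ∀ i ∈ range (n + 1), t + i ≠ 0) :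
    kernel n t =
      ∑ i ∈ range (n + 1), ((coefA n i : ℝ) / (t + i) ^ 2 + ((coefB n i : ℚ) : ℝ) / (t + i)) := by
  have hden : den n t ≠ 0 := by
    rw [den]
    exact prod_ne_zero_iff.2 fun i hi => pow_ne_zero 2 (ht i hi)
  rw [kernel, ← eval_numPoly, numPoly_eq_sum_summand, eval_finsetSum, sum_div]
  refine sum_congr rfl fun i hi => ?_
  have hM : ((∏ l ∈ (range (n + 1)).erase i, (X + C ((l : ℕ) : ℝ)) ^ 2)).eval t ≠ 0 := by
    intro h
    apply hden
    rw [den_eq_mul_eval_piecePoly hi, h, mul_zero]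
  rw [den_eq_mul_eval_piecePoly hi]
  simp only [eval_mul, eval_add, eval_C, eval_X]
  have hti : t + i ≠ 0 := ht i hi
  field_simp

/-- The expansion at the positive integers `t + 1`, `t : ℕ` (the form consumed by the series
identity `DilogPade.form_eq_of_partialFractions`). [cite: DavidHirataKohnoKawashima2020, Thm 2.1] -/
theorem kernel_succ_eq_partialFractions (n t : ℕ) :
    kernel n ((t : ℝ) + 1) =
      ∑ i ∈ range (n + 1),
        ((coefA n i : ℝ) / ((t : ℝ) + 1 + i) ^ 2 + ((coefB n i : ℚ) : ℝ) / ((t : ℝ) + 1 + i)) :=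
  kernel_eq_partialFractions n fun i _ => by positivity

end DilogPade

end Literature.NumberTheory.DiophantineApproximation
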